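import Summits.Ventures.HodgeRepro2.T5InertAdjointRelation

/-!
# The structure constants of `H(U(2,1), K)` from the degree sequence: `cₙ = q − 1`, `dₙ = q⁴`
(cell pub-hodge-repro2, seat p3)

Tier-5 N3 support. Files 189–191 put the three-term recurrence `T₁ · T_{n+1} = T_{n+2} + cₙ T_{n+1} + dₙ Tₙ`
of the spherical Hecke algebra at an inert place in kernel form and tied its constants to the degrees
`deg T_m = #(K a_m K / K)`: `dₙ · deg Tₙ = deg T_{n+1}` and
`cₙ · deg T_{n+1} = deg T₁ · deg T_{n+1} − deg T_{n+2} − deg T_{n+1}`. Here the arithmetic is completed: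
given the printed shape of the degree sequence — `deg T₁ = q⁴ + q` and `deg T_{n+1} = q⁴ · deg Tₙ` for
`n ≥ 1` (i.e. `deg Tₙ = (q³ + 1) q^{4n−3}`, `q = #(R/ϖ)`), with the degrees non-zero in `k` — the
structure constants are the printed ones:

* **`d_eq_of_degrees`** — `dₙ = q⁴` for `n ≥ 1`, and `d₀ = q⁴ + q` (`d_zero_eq_of_degrees`);
* **`c_eq_of_degrees`** — `cₙ = q − 1` for every `n`;
* **`mul_cellU_eq_of_degrees`** — `T₁ · T_{n+2} = T_{n+3} + (q − 1) · T_{n+2} + q⁴ · T_{n+1}` and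
  **`mul_cellU_one_eq_of_degrees`** — `T₁ · T₁ = T₂ + (q − 1) · T₁ + (q⁴ + q) · T₀`:
  THE TREE RECURSION OF `H(U(2,1), K)` (Satake / Macdonald) in kernel, modulo the degree sequence.

The degree hypotheses are explicit Prop arguments (`hdeg₁`, `hdeg`, `hne`), stated in the tree's
vocabulary; they are the one printed count left to the prose of the N3 lane.

Mathlib + this seat's files 189–191 and their imports; no display; no device. §8(d): uses an L-value-free
non-vanishing device: NO.
-/

namespace Summit.Ventures.HodgeRepro2.T5InertStructureConstants

open Summit.Ventures.HodgeRepro2.T5HeckeBasisCells Summit.Ventures.HodgeRepro2.T5HermitianThreeElements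
  Summit.Ventures.HodgeRepro2.T5UnitaryGroupForm Summit.Ventures.HodgeRepro2.T5UnitaryHeckeAdjoint
  Summit.Ventures.HodgeRepro2.T5HeckeDoubleCoset Summit.Ventures.HodgeRepro2.T5HeckePermutationModule
  Summit.Ventures.HodgeRepro2.T5InertTopCoefficient Summit.Ventures.HodgeRepro2.T5InertThreeTermRecurrence
  Summit.Ventures.HodgeRepro2.T5InertDegreeRelation Summit.Ventures.HodgeRepro2.T5InertAdjointRelation

section Constants

variable {R E : Type*} [CommRing R] [Field E] [StarRing E] [Algebra R E] [IsFractionRing R E] [IsDomain R]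
  [IsDiscreteValuationRing R] [Finite (IsLocalRing.ResidueField R)]
  (hstar : ∀ x : E, IsLocalization.IsInteger R x → IsLocalization.IsInteger R (star x))
  (u : E) (hsu : star u = u) (hu0 : u ≠ 0) (hu : IsLocalization.IsInteger R u)
  (hu' : IsLocalization.IsInteger R u⁻¹) {ϖ : R} (hϖ : Irreducible ϖ)
  (hs : star (algebraMap R E ϖ) = algebraMap R E ϖ) (k : Type*) [Field k] (q : k)
  (hdeg₁ : ((MulAction.orbit (hyperspecialSubgroup R (J3 u))
    ((cellU hϖ hs u 1 : formUnitaryGroup (J3 u)) :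
      formUnitaryGroup (J3 u) ⧸ hyperspecialSubgroup R (J3 u))).ncard : k) = q ^ 4 + q)
  (hdeg : ∀ n : ℕ, 1 ≤ n →
    ((MulAction.orbit (hyperspecialSubgroup R (J3 u))
      ((cellU hϖ hs u (n + 1) : formUnitaryGroup (J3 u)) :
        formUnitaryGroup (J3 u) ⧸ hyperspecialSubgroup R (J3 u))).ncard : k) =
      q ^ 4 * ((MulAction.orbit (hyperspecialSubgroup R (J3 u))
        ((cellU hϖ hs u n : formUnitaryGroup (J3 u)) :
          formUnitaryGroup (J3 u) ⧸ hyperspecialSubgroup R (J3 u))).ncard : k))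
  (hne : ∀ n : ℕ, ((MulAction.orbit (hyperspecialSubgroup R (J3 u))
    ((cellU hϖ hs u n : formUnitaryGroup (J3 u)) :
      formUnitaryGroup (J3 u) ⧸ hyperspecialSubgroup R (J3 u))).ncard : k) ≠ 0)

include hstar hu0 hu hu' hdeg hne in
/-- **`dₙ = q⁴` for `n ≥ 1`**: from `dₙ · deg Tₙ = deg T_{n+1} = q⁴ · deg Tₙ` (file 191 and the degree
hypothesis), cancelling `deg Tₙ ≠ 0`. -/
theorem d_eq_of_degrees (n : ℕ) (hn : 1 ≤ n) :
    (((doubleCosetOp k (hyperspecialSubgroup R (J3 u)) (cellU hϖ hs u 1) *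
        doubleCosetOp k (hyperspecialSubgroup R (J3 u)) (cellU hϖ hs u (n + 1)) :
        heckeAlgebra k (hyperspecialSubgroup R (J3 u))) :
        Module.End k (MonoidAlgebra k (formUnitaryGroup (J3 u) ⧸ hyperspecialSubgroup R (J3 u))))
      (MonoidAlgebra.single ((1 : formUnitaryGroup (J3 u)) :
        formUnitaryGroup (J3 u) ⧸ hyperspecialSubgroup R (J3 u)) 1)).coeff
      ((cellU hϖ hs u n : formUnitaryGroup (J3 u)) :
        formUnitaryGroup (J3 u) ⧸ hyperspecialSubgroup R (J3 u)) = q ^ 4 := by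
  have h := adjoint_relation hstar u hu0 hu hu' hϖ hs k n
  rw [hdeg n hn] at h
  exact mul_right_cancel₀ (hne n) h

include hdeg₁ in
/-- **`d₀ = q⁴ + q`**: the constant term of `T₁ · T₁` is `deg T₁` (file 190). -/
theorem d_zero_eq_of_degrees :
    (((doubleCosetOp k (hyperspecialSubgroup R (J3 u)) (cellU hϖ hs u 1) *
        doubleCosetOp k (hyperspecialSubgroup R (J3 u)) (cellU hϖ hs u 1) :
        heckeAlgebra k (hyperspecialSubgroup R (J3 u))) :
        Module.End k (MonoidAlgebra k (formUnitaryGroup (J3 u) ⧸ hyperspecialSubgroup R (J3 u))))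
      (MonoidAlgebra.single ((1 : formUnitaryGroup (J3 u)) :
        formUnitaryGroup (J3 u) ⧸ hyperspecialSubgroup R (J3 u)) 1)).coeff
      ((cellU hϖ hs u 0 : formUnitaryGroup (J3 u)) :
        formUnitaryGroup (J3 u) ⧸ hyperspecialSubgroup R (J3 u)) = q ^ 4 + q := by
  rw [coeff_cellU_zero_eq_ncard, hdeg₁]

include hstar hsu hu0 hu hu' hdeg₁ hdeg hne in
/-- **`cₙ = q − 1`** for every `n`: from `cₙ · deg T_{n+1} = deg T₁ · deg T_{n+1} − deg T_{n+2} − deg T_{n+1}`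
(file 191) with `deg T₁ = q⁴ + q` and `deg T_{n+2} = q⁴ · deg T_{n+1}`, cancelling `deg T_{n+1} ≠ 0`. -/
theorem c_eq_of_degrees (n : ℕ) :
    (((doubleCosetOp k (hyperspecialSubgroup R (J3 u)) (cellU hϖ hs u 1) *
        doubleCosetOp k (hyperspecialSubgroup R (J3 u)) (cellU hϖ hs u (n + 1)) :
        heckeAlgebra k (hyperspecialSubgroup R (J3 u))) :
        Module.End k (MonoidAlgebra k (formUnitaryGroup (J3 u) ⧸ hyperspecialSubgroup R (J3 u))))
      (MonoidAlgebra.single ((1 : formUnitaryGroup (J3 u)) :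
        formUnitaryGroup (J3 u) ⧸ hyperspecialSubgroup R (J3 u)) 1)).coeff
      ((cellU hϖ hs u (n + 1) : formUnitaryGroup (J3 u)) :
        formUnitaryGroup (J3 u) ⧸ hyperspecialSubgroup R (J3 u)) = q - 1 := by
  have h := structure_constant_eq_of_degrees hstar u hsu hu0 hu hu' hϖ hs k n
  rw [hdeg₁, hdeg (n + 1) (Nat.le_add_left 1 n)] at h
  refine mul_right_cancel₀ (hne (n + 1)) ?_
  rw [h]
  ring

include hstar hsu hu0 hu hu' hdeg₁ hdeg hne in
/-- **The tree recursion of `H(U(2,1), K)`**, `n ≥ 1`: `T₁ · T_{n+1} = T_{n+2} + (q − 1) · T_{n+1} + q⁴ · Tₙ`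
(stated with `n + 1` in place of `n`). -/
theorem mul_cellU_eq_of_degrees (n : ℕ) :
    heckeBasisCells hstar u hsu hu0 hu hu' hϖ hs k 1 *
        heckeBasisCells hstar u hsu hu0 hu hu' hϖ hs k (n + 1 + 1) =
      heckeBasisCells hstar u hsu hu0 hu hu' hϖ hs k (n + 1 + 1 + 1) +
        (q - 1) • heckeBasisCells hstar u hsu hu0 hu hu' hϖ hs k (n + 1 + 1) +
        q ^ 4 • heckeBasisCells hstar u hsu hu0 hu hu' hϖ hs k (n + 1) := by
  have h := mul_cellU_eq_three_term hstar u hsu hu0 hu hu' hϖ hs k (n + 1)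
  rw [c_eq_of_degrees hstar u hsu hu0 hu hu' hϖ hs k q hdeg₁ hdeg hne (n + 1),
    d_eq_of_degrees hstar u hu0 hu hu' hϖ hs k q hdeg hne (n + 1) (Nat.le_add_left 1 n)] at h
  exact h

include hstar hsu hu0 hu hu' hdeg₁ hdeg hne in
/-- **The tree recursion at `n = 0`**: `T₁ · T₁ = T₂ + (q − 1) · T₁ + (q⁴ + q) · T₀`. -/
theorem mul_cellU_one_eq_of_degrees :
    heckeBasisCells hstar u hsu hu0 hu hu' hϖ hs k 1 * heckeBasisCells hstar u hsu hu0 hu hu' hϖ hs k (0 + 1) =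
      heckeBasisCells hstar u hsu hu0 hu hu' hϖ hs k (0 + 1 + 1) +
        (q - 1) • heckeBasisCells hstar u hsu hu0 hu hu' hϖ hs k (0 + 1) +
        (q ^ 4 + q) • heckeBasisCells hstar u hsu hu0 hu hu' hϖ hs k 0 := by
  have h := mul_cellU_eq_three_term hstar u hsu hu0 hu hu' hϖ hs k 0
  rw [c_eq_of_degrees hstar u hsu hu0 hu hu' hϖ hs k q hdeg₁ hdeg hne 0] at h
  have hd := d_zero_eq_of_degrees u hϖ hs k q hdeg₁
  rw [show (0 : ℕ) + 1 = 1 from rfl] at h ⊢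
  rw [hd] at h
  exact h

end Constants

end Summit.Ventures.HodgeRepro2.T5InertStructureConstants
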